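import Literature.MathematicalPhysics.KineticTheory.IllnerShinbrotLineBound
import Literature.MathematicalPhysics.KineticTheory.IllnerShinbrotCollisionEstimates
import Literature.MathematicalPhysics.KineticTheory.LanfordPicard
import HarnessLib

/-!
# The Picard map of the rare-cloud problem in the dispersive weighted class

Topic: MathematicalPhysics / KineticTheory. Third layer of the existence half of the named fact
`Literature.MathematicalPhysics.KineticTheory.illner_pulvirenti` (global validity of the
Boltzmann equation for a rare gas cloud in all space; Cercignani–Illner–Pulvirenti 1994
Thm 4.5.1 and Thm 5.2.2 = Illner–Shinbrot 1984): the global-in-time Picard map on `ℝ^d × ℝ^d`.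

For a continuous datum `f₀` on `ℝ^d × ℝ^d` the (positive-time) Picard map of the mild
hard-sphere Boltzmann equation on the whole space, written at the foot of the backward
characteristic, is

  `Φ(u)(t, y, v) = f₀(y - t⁺ v, v) + ∫₀^{t⁺} Q̃(u(τ, y - (t⁺ - τ) v, ·))(v) dτ`, `t⁺ = t ∨ 0`,

with the sign-corrected collision operator
`Q̃(p)(v) = ∫∫ ((v - v_*)·ω)_+ (|p(v')| |p(v_*')| - p(v) |p(v_*)|) dω dv_*` of `LanfordPicard`
(Kaniel–Shinbrot; equal to `Q(p, p)` when `p ≥ 0`). There is NO upper time clamp: the theory is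
global. The weighted ball is the dispersive one of Illner–Shinbrot,

  `|u(t, y, v)| ≤ R e^{-(β/2)(|y - t⁺ v|² + |v|²)}`     (CIP 1994 (2.5) p. 137, (5.4) p. 89),

i.e. `u♯(t, x, v) = u(t, x + tv, v)` is dominated by the FIXED Gaussian `R e^{-(β/2)(|x|² + |v|²)}`.
This file proves, for jointly continuous `u` in that ball:

* `continuous_absCollision_slice'` — the position-generic form of
  `continuous_absCollision_slice` (any topological space of positions);
* `continuous_vacuumPicard` — `Φ(u)` is jointly continuous;
* `abs_vacuumPicard_le` — the ball is invariant as soon as `K_f + 4 |S^{d-1}| K_β R² ≤ R`,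
  where `|f₀(x, v)| ≤ K_f e^{-(β/2)(|x|² + |v|²)}` and
  `K_β = (2π/β)^{1/2} ∫ e^{-(β/2)|w|²} dw` is the dispersive constant of
  `intervalIntegral_dispersiveMajorant_le` (the collision term along a characteristic is bounded
  by `4|S| R² e^{-(β/2)(|x|²+|v|²)} D(x, v, τ)` by `absCollision_bound_dispersive`, and
  `∫₀^t D ≤ K_β` uniformly — this is where the theory becomes global);
* `abs_vacuumPicard_sub_le` — on that ball `Φ` is Lipschitz with constant `4 |S^{d-1}| K_β R`
  in the dispersive weighted norms.

No definitions are introduced: `Q̃` and `Φ` enter through characterising hypotheses.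

## References

* C. Cercignani, R. Illner, M. Pulvirenti, *The Mathematical Theory of Dilute Gases*, Applied
  Mathematical Sciences 106, Springer (1994), §4.5 (Thm 4.5.1, Step 3, pp. 88–90), §5.2
  (Kaniel–Shinbrot scheme (2.1)–(2.4) pp. 136–137, Thm 5.2.2 p. 137).
* R. Illner, M. Shinbrot, *The Boltzmann equation: global existence for a rare gas in an
  infinite vacuum*, Comm. Math. Phys. 95 (1984) 217–226.
* S. Kaniel, M. Shinbrot, *The Boltzmann equation. I. Uniqueness and local existence*,
  Comm. Math. Phys. 58 (1978) 65–84.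
-/

open MeasureTheory Metric Real Set Filter Topology
open scoped InnerProductSpace ENNReal
open Literature.Analysis.FluidPDE

namespace Literature.MathematicalPhysics.KineticTheory

noncomputable section

section Picard

variable {d : Type*} [Fintype d]

/-! ## Joint continuity -/

/-- **Joint continuity of the sign-corrected collision term, any position space.** If
`u(t, y, v)` is jointly continuous on `ℝ × X × ℝ^d` with `|u| ≤ R e^{-γ|v|²/2}`, `γ > 0`, then
`(t, y, v) ↦ Q̃(u(t, y, ·))(v)` is jointly continuous (dominated convergence in `ω` on the finite
sphere measure, then in `v_*` against `(1 + |v_*|) e^{-γ|v_*|²/2}`). This is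
`continuous_absCollision_slice` with the torus replaced by an arbitrary topological space of
positions; the proof is the same. [folklore] -/
theorem continuous_absCollision_slice' {X : Type*} [TopologicalSpace X] [FirstCountableTopology X]
    {Qa : (EuclideanSpace ℝ d → ℝ) → EuclideanSpace ℝ d → ℝ}
    (hQa : ∀ p v, Qa p v = ∫ w, ∫ ω, hardSphereKernel (v, w) ω *
      (|p (collide ω (v, w)).1| * |p (collide ω (v, w)).2| - p v * |p w|) ∂sphereMeasure)
    {u : ℝ → X → EuclideanSpace ℝ d → ℝ}
    (hu : Continuous fun z : ℝ × X × EuclideanSpace ℝ d => u z.1 z.2.1 z.2.2)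
    {R γ : ℝ} (hγ : 0 < γ) (hub : ∀ t y v, |u t y v| ≤ R * exp (-(γ / 2) * ‖v‖ ^ 2)) :
    Continuous fun z : ℝ × X × EuclideanSpace ℝ d => Qa (u z.1 z.2.1) z.2.2 := by
  haveI := isFiniteMeasure_sphereMeasure (E := EuclideanSpace ℝ d)
  -- the integrand, on `((t, y, v), w)` and `ω`
  set I : (ℝ × X × EuclideanSpace ℝ d) × EuclideanSpace ℝ d →
      sphere (0 : EuclideanSpace ℝ d) 1 → ℝ := fun q ω =>
    hardSphereKernel (q.1.2.2, q.2) ω *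
      (|u q.1.1 q.1.2.1 (collide ω (q.1.2.2, q.2)).1| * |u q.1.1 q.1.2.1 (collide ω (q.1.2.2, q.2)).2| -
        u q.1.1 q.1.2.1 q.1.2.2 * |u q.1.1 q.1.2.1 q.2|) with hI
  set ψ : EuclideanSpace ℝ d → ℝ := fun x => (1 + ‖x‖) * exp (-(γ / 2) * ‖x‖ ^ 2) with hψ
  have hψ0 : ∀ x, 0 ≤ ψ x := fun x => by positivity
  have hψle : ∀ x, ψ x ≤ 1 + ‖x‖ := fun x => by
    simp only [hψ]
    refine mul_le_of_le_one_right (by positivity) (exp_le_one_iff.2 ?_)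
    nlinarith [sq_nonneg ‖x‖, hγ.le]
  -- pointwise bound
  have hIb : ∀ q ω, |I q ω| ≤ 2 * R ^ 2 * (ψ q.1.2.2 * ψ q.2) := fun q ω =>
    abs_absCollisionIntegrand_le (p := u q.1.1 q.1.2.1) (fun w => hub _ _ w) q.1.2.2 q.2 ω
  -- joint continuity of the integrand
  have hIc : Continuous fun s : ((ℝ × X × EuclideanSpace ℝ d) × EuclideanSpace ℝ d) ×
      sphere (0 : EuclideanSpace ℝ d) 1 => I s.1 s.2 := by
    have hU : ∀ {g₁ : ((ℝ × X × EuclideanSpace ℝ d) × EuclideanSpace ℝ d) ×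
          sphere (0 : EuclideanSpace ℝ d) 1 → ℝ}
        {g₂ : ((ℝ × X × EuclideanSpace ℝ d) × EuclideanSpace ℝ d) ×
          sphere (0 : EuclideanSpace ℝ d) 1 → X}
        {g₃ : ((ℝ × X × EuclideanSpace ℝ d) × EuclideanSpace ℝ d) ×
          sphere (0 : EuclideanSpace ℝ d) 1 → EuclideanSpace ℝ d},
        Continuous g₁ → Continuous g₂ → Continuous g₃ →
          Continuous fun s => u (g₁ s) (g₂ s) (g₃ s) :=
      fun h1 h2 h3 => hu.comp (h1.prodMk (h2.prodMk h3))
    have hB : Continuous fun s : ((ℝ × X × EuclideanSpace ℝ d) ×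
        EuclideanSpace ℝ d) × sphere (0 : EuclideanSpace ℝ d) 1 =>
        hardSphereKernel (s.1.1.2.2, s.1.2) s.2 := by
      unfold hardSphereKernel
      fun_prop
    have hcol : Continuous fun s : ((ℝ × X × EuclideanSpace ℝ d) ×
        EuclideanSpace ℝ d) × sphere (0 : EuclideanSpace ℝ d) 1 =>
        collide s.2 (s.1.1.2.2, s.1.2) :=
      continuous_collide_uncurry.comp
        ((continuous_fst.snd.snd.prodMk continuous_snd).fst'.prodMk continuous_snd :
          Continuous fun s : ((ℝ × X × EuclideanSpace ℝ d) ×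
            EuclideanSpace ℝ d) × sphere (0 : EuclideanSpace ℝ d) 1 => ((s.1.1.2.2, s.1.2), s.2))
    have hy : Continuous fun s : ((ℝ × X × EuclideanSpace ℝ d) ×
        EuclideanSpace ℝ d) × sphere (0 : EuclideanSpace ℝ d) 1 => s.1.1.2.1 := by fun_prop
    have ht : Continuous fun s : ((ℝ × X × EuclideanSpace ℝ d) ×
        EuclideanSpace ℝ d) × sphere (0 : EuclideanSpace ℝ d) 1 => s.1.1.1 := by fun_prop
    simp only [hI]
    exact hB.mul (((hU ht hy hcol.fst).abs.mul (hU ht hy hcol.snd).abs).sub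
      ((hU ht hy (by fun_prop)).mul (hU ht hy (by fun_prop)).abs))
  -- Step A: the `dω` integral is jointly continuous in `((t, y, v), w)`
  have hg : Continuous fun q : (ℝ × X × EuclideanSpace ℝ d) × EuclideanSpace ℝ d =>
      ∫ ω, I q ω ∂sphereMeasure := by
    refine continuous_iff_continuousAt.2 fun q₀ => ?_
    set C : ℝ := 2 * R ^ 2 * ((2 + ‖q₀.1.2.2‖) * (2 + ‖q₀.2‖)) with hC
    have hUq : {q : (ℝ × X × EuclideanSpace ℝ d) × EuclideanSpace ℝ d |
        ‖q.1.2.2‖ < ‖q₀.1.2.2‖ + 1 ∧ ‖q.2‖ < ‖q₀.2‖ + 1} ∈ 𝓝 q₀ := by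
      refine IsOpen.mem_nhds ?_ ?_
      · exact (isOpen_lt continuous_fst.snd.snd.norm continuous_const).inter
          (isOpen_lt continuous_snd.norm continuous_const)
      · show ‖q₀.1.2.2‖ < ‖q₀.1.2.2‖ + 1 ∧ ‖q₀.2‖ < ‖q₀.2‖ + 1
        exact ⟨lt_add_one _, lt_add_one _⟩
    refine continuousAt_of_dominated (bound := fun _ => C) ?_ ?_ (integrable_const C) ?_
    · exact Eventually.of_forall fun q =>
        (hIc.comp (continuous_const.prodMk continuous_id)).aestronglyMeasurable
    · filter_upwards [hUq] with q hq
      refine Eventually.of_forall fun ω => ?_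
      rw [Real.norm_eq_abs]
      refine (hIb q ω).trans ?_
      have e1 : ψ q.1.2.2 ≤ 2 + ‖q₀.1.2.2‖ := (hψle _).trans (by linarith [hq.1])
      have e2 : ψ q.2 ≤ 2 + ‖q₀.2‖ := (hψle _).trans (by linarith [hq.2])
      have := hψ0 q.1.2.2
      have := hψ0 q.2
      simp only [hC]
      gcongr
    · exact Eventually.of_forall fun ω =>
        (hIc.comp (continuous_id.prodMk continuous_const)).continuousAt
  -- Step B: the `dw` integral is continuous in `(t, y, v)`
  have hF : Continuous fun z : ℝ × X × EuclideanSpace ℝ d =>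
      ∫ w, (∫ ω, I (z, w) ω ∂sphereMeasure) := by
    refine continuous_iff_continuousAt.2 fun z₀ => ?_
    set S : ℝ := (sphereMeasure : Measure (sphere (0 : EuclideanSpace ℝ d) 1)).real univ with hS
    set bound : EuclideanSpace ℝ d → ℝ := fun w => S * (2 * R ^ 2 * (2 + ‖z₀.2.2‖)) * ψ w
      with hbound
    have hUz : {z : ℝ × X × EuclideanSpace ℝ d | ‖z.2.2‖ < ‖z₀.2.2‖ + 1} ∈ 𝓝 z₀ :=
      IsOpen.mem_nhds (isOpen_lt continuous_snd.snd.norm continuous_const)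
        (show ‖z₀.2.2‖ < ‖z₀.2.2‖ + 1 from lt_add_one _)
    refine continuousAt_of_dominated (bound := bound) ?_ ?_ ?_ ?_
    · exact Eventually.of_forall fun z =>
        (hg.comp (continuous_const.prodMk continuous_id)).aestronglyMeasurable
    · filter_upwards [hUz] with z hz
      refine Eventually.of_forall fun w => ?_
      have e1 : ψ z.2.2 ≤ 2 + ‖z₀.2.2‖ := (hψle _).trans (by linarith [hz])
      calc ‖∫ ω, I (z, w) ω ∂sphereMeasure‖ ≤ ∫ ω, ‖I (z, w) ω‖ ∂sphereMeasure :=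
            norm_integral_le_integral_norm _
        _ ≤ ∫ _ω, 2 * R ^ 2 * (ψ z.2.2 * ψ w) ∂sphereMeasure :=
            integral_mono_of_nonneg (Eventually.of_forall fun _ => norm_nonneg _)
              (integrable_const _)
              (Eventually.of_forall fun ω => by dsimp only; rw [Real.norm_eq_abs]; exact hIb (z, w) ω)
        _ = S * (2 * R ^ 2 * (ψ z.2.2 * ψ w)) := by rw [integral_const, smul_eq_mul, hS]
        _ ≤ S * (2 * R ^ 2 * ((2 + ‖z₀.2.2‖) * ψ w)) := by
            have := hψ0 w
            have : (0 : ℝ) ≤ S := measureReal_nonneg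
            gcongr
        _ = bound w := by simp only [hbound]; ring
    · exact (integrable_one_add_norm_mul_exp hγ).const_mul _
    · exact Eventually.of_forall fun w =>
        (hg.comp (continuous_id.prodMk continuous_const)).continuousAt
  have hQF : (fun z : ℝ × X × EuclideanSpace ℝ d => Qa (u z.1 z.2.1) z.2.2) =
      fun z => ∫ w, (∫ ω, I (z, w) ω ∂sphereMeasure) := by
    funext z
    rw [hQa]
  rw [hQF]
  exact hF

/-- **Joint continuity of the whole-space Picard map.** For jointly continuous `u` with a
Gaussian velocity bound and a continuous datum `f₀` on `ℝ^d × ℝ^d`, the positive-time Picard map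
`Φ(u)(t, y, v) = f₀(y - t⁺v, v) + ∫₀^{t⁺} Q̃(u(τ, y - (t⁺-τ)v, ·))(v) dτ`, `t⁺ = t ∨ 0`, is jointly
continuous on `ℝ × ℝ^d × ℝ^d` (parametric interval integral of a continuous integrand). [folklore] -/
theorem continuous_vacuumPicard
    {Qa : (EuclideanSpace ℝ d → ℝ) → EuclideanSpace ℝ d → ℝ}
    (hQa : ∀ p v, Qa p v = ∫ w, ∫ ω, hardSphereKernel (v, w) ω *
      (|p (collide ω (v, w)).1| * |p (collide ω (v, w)).2| - p v * |p w|) ∂sphereMeasure)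
    {u : ℝ → EuclideanSpace ℝ d → EuclideanSpace ℝ d → ℝ}
    (hu : Continuous fun z : ℝ × EuclideanSpace ℝ d × EuclideanSpace ℝ d => u z.1 z.2.1 z.2.2)
    {R γ : ℝ} (hγ : 0 < γ) (hub : ∀ t y v, |u t y v| ≤ R * exp (-(γ / 2) * ‖v‖ ^ 2))
    {f₀ : EuclideanSpace ℝ d → EuclideanSpace ℝ d → ℝ} (hf₀ : Continuous (Function.uncurry f₀)) :
    Continuous fun z : ℝ × EuclideanSpace ℝ d × EuclideanSpace ℝ d =>
      f₀ (z.2.1 - max 0 z.1 • z.2.2) z.2.2 +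
        ∫ τ in (0 : ℝ)..max 0 z.1, Qa (u τ (z.2.1 - (max 0 z.1 - τ) • z.2.2)) z.2.2 := by
  have hF := continuous_absCollision_slice' hQa hu hγ hub
  have hc : Continuous fun t : ℝ => max 0 t := by fun_prop
  refine Continuous.add ?_ ?_
  · exact hf₀.comp (by fun_prop : Continuous fun z : ℝ × EuclideanSpace ℝ d × EuclideanSpace ℝ d =>
      (z.2.1 - max 0 z.1 • z.2.2, z.2.2))
  · refine intervalIntegral.continuous_parametric_intervalIntegral_of_continuous
      (f := fun (z : ℝ × EuclideanSpace ℝ d × EuclideanSpace ℝ d) (τ : ℝ) =>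
        Qa (u τ (z.2.1 - (max 0 z.1 - τ) • z.2.2)) z.2.2) ?_ (hc.comp continuous_fst)
    exact hF.comp (by fun_prop : Continuous fun q : (ℝ × EuclideanSpace ℝ d × EuclideanSpace ℝ d) × ℝ =>
      (q.2, q.1.2.1 - (max 0 q.1.1 - q.2) • q.1.2.2, q.1.2.2))

/-! ## Ball invariance and contraction in the dispersive weights -/

/-- The dispersive weight is below the plain velocity Gaussian:
`e^{-(β/2)(a² + |v|²)} ≤ e^{-(β/2)|v|²}` for `β ≥ 0`. [folklore] -/
theorem exp_dispersive_le_exp_velocity {β : ℝ} (hβ : 0 ≤ β) (a : ℝ) (v : EuclideanSpace ℝ d) :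
    exp (-(β / 2) * (a ^ 2 + ‖v‖ ^ 2)) ≤ exp (-(β / 2) * ‖v‖ ^ 2) := by
  refine exp_le_exp.2 ?_
  nlinarith [sq_nonneg a]

omit [Fintype d] in
/-- The foot of the backward characteristic: `y - (t' - τ) v = (y - t' v) + τ v`. [folklore] -/
theorem sub_sub_smul_eq (y v : EuclideanSpace ℝ d) (t' τ : ℝ) :
    y - (t' - τ) • v = (y - t' • v) + τ • v := by
  rw [sub_smul]
  abel

/-- **Invariance of the dispersive ball under the whole-space Picard map** (the a priori bound
of CIP 1994 §4.5 Step 3 / Thm 5.2.2 (2.5), Illner–Shinbrot 1984: "if `b·α` is sufficiently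
small"). Let `β > 0`, `|f₀(x, v)| ≤ K_f e^{-(β/2)(|x|² + |v|²)}`, and let `u` be jointly
continuous with `|u(t, y, v)| ≤ R e^{-(β/2)(|y - t⁺v|² + |v|²)}`. If
`K_f + 4 |S^{d-1}| K_β R² ≤ R`, `K_β = (2π/β)^{1/2} ∫ e^{-(β/2)|w|²} dw`, then
`|Φ(u)(t, y, v)| ≤ R e^{-(β/2)(|y - t⁺v|² + |v|²)}`: along the characteristic with foot
`x = y - t⁺v` the datum contributes `K_f e^{-(β/2)(|x|²+|v|²)}` and the collision integral at most
`4|S| R² e^{-(β/2)(|x|²+|v|²)} ∫₀^{t⁺} D(x, v, τ) dτ ≤ 4|S| R² K_β e^{-(β/2)(|x|²+|v|²)}`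
(`absCollision_bound_dispersive`, `intervalIntegral_dispersiveMajorant_le`).
[cite: CIP1994, Thm 5.2.2 (2.5) and §4.5 (5.1)–(5.9)] -/
theorem abs_vacuumPicard_le
    {Qa : (EuclideanSpace ℝ d → ℝ) → EuclideanSpace ℝ d → ℝ}
    (hQa : ∀ p v, Qa p v = ∫ w, ∫ ω, hardSphereKernel (v, w) ω *
      (|p (collide ω (v, w)).1| * |p (collide ω (v, w)).2| - p v * |p w|) ∂sphereMeasure)
    {β R Kf : ℝ} (hβ : 0 < β) (hR : 0 ≤ R)
    {f₀ : EuclideanSpace ℝ d → EuclideanSpace ℝ d → ℝ}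
    (hf₀b : ∀ x v, |f₀ x v| ≤ Kf * exp (-(β / 2) * (‖x‖ ^ 2 + ‖v‖ ^ 2)))
    {u : ℝ → EuclideanSpace ℝ d → EuclideanSpace ℝ d → ℝ}
    (hu : Continuous fun z : ℝ × EuclideanSpace ℝ d × EuclideanSpace ℝ d => u z.1 z.2.1 z.2.2)
    (hub : ∀ t y v, |u t y v| ≤ R * exp (-(β / 2) * (‖y - max 0 t • v‖ ^ 2 + ‖v‖ ^ 2)))
    (hsmall : Kf + 4 * (sphereMeasure : Measure (sphere (0 : EuclideanSpace ℝ d) 1)).real univ *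
        (√(2 * π / β) * ∫ w : EuclideanSpace ℝ d, exp (-(β / 2) * ‖w‖ ^ 2)) * R * R ≤ R)
    (t : ℝ) (y v : EuclideanSpace ℝ d) :
    |f₀ (y - max 0 t • v) v +
        ∫ τ in (0 : ℝ)..max 0 t, Qa (u τ (y - (max 0 t - τ) • v)) v| ≤
      R * exp (-(β / 2) * (‖y - max 0 t • v‖ ^ 2 + ‖v‖ ^ 2)) := by
  -- constants, the clamped time and the foot of the characteristic
  set S : ℝ := (sphereMeasure : Measure (sphere (0 : EuclideanSpace ℝ d) 1)).real univ with hS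
  set Kβ : ℝ := √(2 * π / β) * ∫ w : EuclideanSpace ℝ d, exp (-(β / 2) * ‖w‖ ^ 2) with hKβ
  have hS0 : 0 ≤ S := measureReal_nonneg
  have hKβ0 : 0 ≤ Kβ := mul_nonneg (Real.sqrt_nonneg _) (integral_nonneg fun w => (exp_pos _).le)
  set t' : ℝ := max 0 t with ht'_def
  have ht' : 0 ≤ t' := le_max_left _ _
  set x : EuclideanSpace ℝ d := y - t' • v with hx
  set W : ℝ := exp (-(β / 2) * (‖x‖ ^ 2 + ‖v‖ ^ 2)) with hW
  have hW0 : 0 ≤ W := (exp_pos _).le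
  have hpos : ∀ τ : ℝ, y - (t' - τ) • v = x + τ • v := fun τ => sub_sub_smul_eq y v t' τ
  -- `Kf ≥ 0` and the datum
  have hKf : 0 ≤ Kf := by
    have h := (abs_nonneg _).trans (hf₀b y v)
    exact nonneg_of_mul_nonneg_left (by linarith [h]) (exp_pos (-(β / 2) * (‖y‖ ^ 2 + ‖v‖ ^ 2)))
  have h1 : |f₀ x v| ≤ Kf * W := hf₀b x v
  -- the velocity Gaussian bound, for continuity and measurability
  have hub' : ∀ s z w, |u s z w| ≤ R * exp (-(β / 2) * ‖w‖ ^ 2) := fun s z w =>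
    (hub s z w).trans (mul_le_mul_of_nonneg_left (exp_dispersive_le_exp_velocity hβ.le _ w) hR)
  have hF := continuous_absCollision_slice' hQa hu hβ hub'
  -- the dispersive majorant along the characteristic
  set D : ℝ → ℝ := fun τ =>
    ∫ w, ‖v - w‖ * exp (-(β / 2) * (‖x + τ • v - τ • w‖ ^ 2 + ‖w‖ ^ 2)) with hD_def
  set b : ℝ → ℝ := fun τ => 4 * S * R * R * W * D τ with hb_def
  have hb_int : IntervalIntegrable b volume 0 t' :=
    (intervalIntegrable_dispersiveMajorant hβ x v 0 t').const_mul (4 * S * R * R * W)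
  have hbound : ∀ τ ∈ Ioc 0 t', ‖Qa (u τ (y - (t' - τ) • v)) v‖ ≤ b τ := by
    intro τ hτ
    rw [hpos τ]
    have hclamp : max 0 τ = τ := max_eq_right hτ.1.le
    set y' : EuclideanSpace ℝ d := x + τ • v with hy'
    have hpm : Measurable (u τ y') :=
      (hu.comp (continuous_const.prodMk (continuous_const.prodMk continuous_id))).measurable
    have hp : ∀ w, |u τ y' w| ≤ R * exp (-(β / 2) * (‖y' - τ • w‖ ^ 2 + ‖w‖ ^ 2)) := fun w => by
      have h := hub τ y' w
      rwa [hclamp] at h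
    have hL := absCollision_bound_dispersive hβ hpm hR hp v
    rw [Real.norm_eq_abs, hQa]
    refine hL.trans (le_of_eq ?_)
    simp only [hb_def, hD_def, hW, hS, hy', add_sub_cancel_right]
  have h2 : |∫ τ in (0 : ℝ)..t', Qa (u τ (y - (t' - τ) • v)) v| ≤ 4 * S * R * R * W * Kβ := by
    rw [← Real.norm_eq_abs]
    refine (intervalIntegral.norm_integral_le_of_norm_le ht' (Eventually.of_forall hbound)
      hb_int).trans ?_
    simp only [hb_def]
    rw [intervalIntegral.integral_const_mul]
    have hC0 : 0 ≤ 4 * S * R * R * W := by positivity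
    exact mul_le_mul_of_nonneg_left (intervalIntegral_dispersiveMajorant_le hβ x v ht') hC0
  -- conclusion
  calc |f₀ x v + ∫ τ in (0 : ℝ)..t', Qa (u τ (y - (t' - τ) • v)) v|
      ≤ |f₀ x v| + |∫ τ in (0 : ℝ)..t', Qa (u τ (y - (t' - τ) • v)) v| := abs_add_le _ _
    _ ≤ Kf * W + 4 * S * R * R * W * Kβ := add_le_add h1 h2
    _ = (Kf + 4 * S * Kβ * R * R) * W := by ring
    _ ≤ R * W := mul_le_mul_of_nonneg_right hsmall hW0

/-- **Lipschitz estimate for the whole-space Picard map on the dispersive ball** (the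
contraction behind CIP 1994 Thm 5.2.2 / §4.5 Step 3; Illner–Shinbrot 1984 §3): if `u, ũ` are
jointly continuous, both bounded by `R e^{-(β/2)(|y - t⁺v|² + |v|²)}` and
`|u - ũ| ≤ D e^{-(β/2)(|y - t⁺v|² + |v|²)}`, then
`|Φ(u) - Φ(ũ)|(t, y, v) ≤ 4 |S^{d-1}| K_β R · D e^{-(β/2)(|y - t⁺v|² + |v|²)}`
(`absCollision_lipschitz_dispersive`, `intervalIntegral_dispersiveMajorant_le`).
[cite: CIP1994, Thm 5.2.2 and §4.5 (5.1)–(5.9)] -/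
theorem abs_vacuumPicard_sub_le
    {Qa : (EuclideanSpace ℝ d → ℝ) → EuclideanSpace ℝ d → ℝ}
    (hQa : ∀ p v, Qa p v = ∫ w, ∫ ω, hardSphereKernel (v, w) ω *
      (|p (collide ω (v, w)).1| * |p (collide ω (v, w)).2| - p v * |p w|) ∂sphereMeasure)
    {β R D : ℝ} (hβ : 0 < β) (hR : 0 ≤ R) (hD : 0 ≤ D)
    (f₀ : EuclideanSpace ℝ d → EuclideanSpace ℝ d → ℝ)
    {u w : ℝ → EuclideanSpace ℝ d → EuclideanSpace ℝ d → ℝ}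
    (hu : Continuous fun z : ℝ × EuclideanSpace ℝ d × EuclideanSpace ℝ d => u z.1 z.2.1 z.2.2)
    (hw : Continuous fun z : ℝ × EuclideanSpace ℝ d × EuclideanSpace ℝ d => w z.1 z.2.1 z.2.2)
    (hub : ∀ t y v, |u t y v| ≤ R * exp (-(β / 2) * (‖y - max 0 t • v‖ ^ 2 + ‖v‖ ^ 2)))
    (hwb : ∀ t y v, |w t y v| ≤ R * exp (-(β / 2) * (‖y - max 0 t • v‖ ^ 2 + ‖v‖ ^ 2)))
    (huw : ∀ t y v, |u t y v - w t y v| ≤ D * exp (-(β / 2) * (‖y - max 0 t • v‖ ^ 2 + ‖v‖ ^ 2)))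
    (t : ℝ) (y v : EuclideanSpace ℝ d) :
    |(f₀ (y - max 0 t • v) v +
        ∫ τ in (0 : ℝ)..max 0 t, Qa (u τ (y - (max 0 t - τ) • v)) v) -
      (f₀ (y - max 0 t • v) v +
        ∫ τ in (0 : ℝ)..max 0 t, Qa (w τ (y - (max 0 t - τ) • v)) v)| ≤
      4 * (sphereMeasure : Measure (sphere (0 : EuclideanSpace ℝ d) 1)).real univ *
        (√(2 * π / β) * ∫ w : EuclideanSpace ℝ d, exp (-(β / 2) * ‖w‖ ^ 2)) * R * D *
        exp (-(β / 2) * (‖y - max 0 t • v‖ ^ 2 + ‖v‖ ^ 2)) := by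
  -- constants, the clamped time and the foot of the characteristic
  set S : ℝ := (sphereMeasure : Measure (sphere (0 : EuclideanSpace ℝ d) 1)).real univ with hS
  set Kβ : ℝ := √(2 * π / β) * ∫ w : EuclideanSpace ℝ d, exp (-(β / 2) * ‖w‖ ^ 2) with hKβ
  have hS0 : 0 ≤ S := measureReal_nonneg
  set t' : ℝ := max 0 t with ht'_def
  have ht' : 0 ≤ t' := le_max_left _ _
  set x : EuclideanSpace ℝ d := y - t' • v with hx
  set W : ℝ := exp (-(β / 2) * (‖x‖ ^ 2 + ‖v‖ ^ 2)) with hW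
  have hW0 : 0 ≤ W := (exp_pos _).le
  have hpos : ∀ τ : ℝ, y - (t' - τ) • v = x + τ • v := fun τ => sub_sub_smul_eq y v t' τ
  -- the velocity Gaussian bounds, for continuity and measurability
  have hweak : ∀ {g : ℝ → EuclideanSpace ℝ d → EuclideanSpace ℝ d → ℝ},
      (∀ t y v, |g t y v| ≤ R * exp (-(β / 2) * (‖y - max 0 t • v‖ ^ 2 + ‖v‖ ^ 2))) →
      ∀ s z w, |g s z w| ≤ R * exp (-(β / 2) * ‖w‖ ^ 2) := fun hg s z w =>
    (hg s z w).trans (mul_le_mul_of_nonneg_left (exp_dispersive_le_exp_velocity hβ.le _ w) hR)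
  have hFu := continuous_absCollision_slice' hQa hu hβ (hweak hub)
  have hFw := continuous_absCollision_slice' hQa hw hβ (hweak hwb)
  -- interval integrability of the two collision terms along the characteristic
  have hchar : Continuous fun τ : ℝ =>
      ((τ, y - (t' - τ) • v, v) : ℝ × EuclideanSpace ℝ d × EuclideanSpace ℝ d) := by fun_prop
  have hIu : IntervalIntegrable (fun τ => Qa (u τ (y - (t' - τ) • v)) v) volume 0 t' :=
    (hFu.comp hchar).intervalIntegrable _ _
  have hIw : IntervalIntegrable (fun τ => Qa (w τ (y - (t' - τ) • v)) v) volume 0 t' :=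
    (hFw.comp hchar).intervalIntegrable _ _
  -- the dispersive majorant along the characteristic
  set Dm : ℝ → ℝ := fun τ =>
    ∫ w, ‖v - w‖ * exp (-(β / 2) * (‖x + τ • v - τ • w‖ ^ 2 + ‖w‖ ^ 2)) with hDm_def
  set b : ℝ → ℝ := fun τ => 4 * S * R * D * W * Dm τ with hb_def
  have hb_int : IntervalIntegrable b volume 0 t' :=
    (intervalIntegrable_dispersiveMajorant hβ x v 0 t').const_mul (4 * S * R * D * W)
  have hbound : ∀ τ ∈ Ioc 0 t',
      ‖Qa (u τ (y - (t' - τ) • v)) v - Qa (w τ (y - (t' - τ) • v)) v‖ ≤ b τ := by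
    intro τ hτ
    rw [hpos τ]
    have hclamp : max 0 τ = τ := max_eq_right hτ.1.le
    set y' : EuclideanSpace ℝ d := x + τ • v with hy'
    have hpm : Measurable (u τ y') :=
      (hu.comp (continuous_const.prodMk (continuous_const.prodMk continuous_id))).measurable
    have hqm : Measurable (w τ y') :=
      (hw.comp (continuous_const.prodMk (continuous_const.prodMk continuous_id))).measurable
    have hp : ∀ z, |u τ y' z| ≤ R * exp (-(β / 2) * (‖y' - τ • z‖ ^ 2 + ‖z‖ ^ 2)) := fun z => by
      have h := hub τ y' z
      rwa [hclamp] at h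
    have hq : ∀ z, |w τ y' z| ≤ R * exp (-(β / 2) * (‖y' - τ • z‖ ^ 2 + ‖z‖ ^ 2)) := fun z => by
      have h := hwb τ y' z
      rwa [hclamp] at h
    have hpq : ∀ z, |u τ y' z - w τ y' z| ≤
        D * exp (-(β / 2) * (‖y' - τ • z‖ ^ 2 + ‖z‖ ^ 2)) := fun z => by
      have h := huw τ y' z
      rwa [hclamp] at h
    have hL := absCollision_lipschitz_dispersive hβ hpm hqm hR hD hp hq hpq v
    rw [Real.norm_eq_abs, hQa, hQa]
    refine hL.trans (le_of_eq ?_)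
    simp only [hb_def, hDm_def, hW, hS, hy', add_sub_cancel_right]
  -- integrate
  rw [add_sub_add_left_eq_sub, ← intervalIntegral.integral_sub hIu hIw, ← Real.norm_eq_abs]
  refine (intervalIntegral.norm_integral_le_of_norm_le ht' (Eventually.of_forall hbound)
    hb_int).trans ?_
  simp only [hb_def]
  rw [intervalIntegral.integral_const_mul]
  have hC0 : 0 ≤ 4 * S * R * D * W := by positivity
  calc 4 * S * R * D * W * ∫ τ in (0 : ℝ)..t', Dm τ ≤ 4 * S * R * D * W * Kβ :=
        mul_le_mul_of_nonneg_left (intervalIntegral_dispersiveMajorant_le hβ x v ht') hC0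
    _ = 4 * S * Kβ * R * D * W := by ring

end Picard

end

end Literature.MathematicalPhysics.KineticTheory
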